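import Literature.Analysis.OperatorTheory.InvariantSubspaceFormProjection
import Mathlib.Analysis.InnerProductSpace.Adjoint
import Mathlib.Analysis.InnerProductSpace.Positive
import HarnessLib

/-!
# The form-domain projection onto a span of weak eigenvectors is also the ambient projection

Analysis/OperatorTheory file (everything proved, no named facts). Setting of
`CompactEmbeddingFormSpectrum.lean` (Kato VI §2.1): `Q` is a Hilbert space (form domain with its
form inner product, e.g. the energy space with `‖·‖_E`), `H` a Hilbert space (e.g. `L²(Ω)`), and
`J : Q →L[𝕜] H` a bounded embedding. Weak eigenvectors of the form are `e ∈ Q` with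

  `⟪e, y⟫_Q = μ ⟪J e, J y⟫_H` for all `y ∈ Q`

(the free Rayleigh quotient `‖y‖_Q² / ‖J y‖_H²` is stationary at `e` with value `μ`). With
`K := J† J : Q →L Q` (bounded, symmetric, positive) this reads `μ K e = e`, so every weak eigenvector
with `μ ≠ 0` is an eigenvector of the BOUNDED operator `K`, the span `V` of a family of them is
`K`-invariant, and `InvariantSubspaceFormProjection.lean` applies with `A = K`: for the
`Q`-orthogonal projection `P` onto `V`

  `⟪J (f − P f), J v⟫_H = 0` for all `v ∈ V`,

i.e. the form-domain (energy) projection onto `V` is ALSO the ambient (`L²`) projection — and it is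
the unique `w ∈ V` with `J (f − w) ⊥_H J V` when `J` is injective on `V` (`starProjection_unique_of_inner_embed`).
Consequences recorded: the ambient Pythagoras `‖J f‖² = ‖J (P f)‖² + ‖J (f − P f)‖²`, and the
finite-span form (`V = span (ψ i)`; for finite `ι` the projection exists).

## Why it is here (source and use)

Elementary (Kato 1980, VI-§2.1: the operator associated with a closed form; [folklore]). It closes the
"operator-realisation hypothesis" left analytic in `pub-nsjs/pub-nsjs-typer/LEMMA-E.md` §10 (E.1 step
(a): `I_N f := P_N f` is both the `L²(Ω)`- and the `E`-projection onto the span `V_N` of the first `N`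
free Rayleigh-quotient eigenfunctions, hence `f^E_or := f − I_N f ⊥_{L²(Ω)} V_N` and
`‖f‖²_{L²} = ‖I_N f‖²_{L²} + ‖f^E_or‖²_{L²}`): NO self-adjoint (Friedrichs) realisation of the energy
operator on `L²(Ω)` is needed — only the bounded map `K = J†J` on the energy space. Jia–Šverák
programme, certified-enclosure lane; the scheme is that of Hou–Wang–Yang, arXiv:2509.25116, which is
under adjudication in that cell and is NOT cited for this step. Nothing about Navier–Stokes is typed.

## References

* T. Kato, *Perturbation Theory for Linear Operators*, 2nd ed. (1980), VI §2.1.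
-/

noncomputable section

open scoped InnerProductSpace

namespace Literature.Analysis.OperatorTheory

variable {Q : Type*} [NormedAddCommGroup Q] [InnerProductSpace ℝ Q] [CompleteSpace Q]
variable {H : Type*} [NormedAddCommGroup H] [InnerProductSpace ℝ H] [CompleteSpace H]

/-- `⟪J†J x, y⟫_Q = ⟪J x, J y⟫_H`. [folklore] -/
theorem inner_adjoint_comp_self_apply (J : Q →L[ℝ] H) (x y : Q) :
    ⟪((ContinuousLinearMap.adjoint J).comp J) x, y⟫_ℝ = ⟪J x, J y⟫_ℝ := by
  simp only [ContinuousLinearMap.coe_comp, Function.comp_apply,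
    ContinuousLinearMap.adjoint_inner_left]

/-- A weak eigenvector of the form (`⟪e, y⟫_Q = μ ⟪J e, J y⟫_H ∀ y`, `μ ≠ 0`) is an eigenvector of the
bounded operator `K = J†J` with eigenvalue `μ⁻¹`. [folklore] -/
theorem adjoint_comp_self_eigen_of_weak (J : Q →L[ℝ] H) {e : Q} {μ : ℝ} (hμ : μ ≠ 0)
    (he : ∀ y : Q, ⟪e, y⟫_ℝ = μ * ⟪J e, J y⟫_ℝ) :
    ((ContinuousLinearMap.adjoint J).comp J) e = μ⁻¹ • e := by
  apply ext_inner_right ℝ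
  intro y
  rw [inner_adjoint_comp_self_apply, inner_smul_left]
  have := he y
  simp only [RCLike.conj_to_real]
  field_simp
  linarith

/-- **Form-domain projection = ambient projection.** If `V ≤ Q` is complete and `K = J†J`-invariant,
then for the `Q`-orthogonal projection `P` onto `V`, `J (f − P f)` is `H`-orthogonal to `J V`.
[folklore] -/
theorem inner_embed_sub_starProjection_eq_zero (J : Q →L[ℝ] H)
    (V : Submodule ℝ Q) [V.HasOrthogonalProjection]
    (hV : ∀ v ∈ V, ((ContinuousLinearMap.adjoint J).comp J) v ∈ V) (f : Q) :
    ∀ v ∈ V, ⟪J (f - V.starProjection f), J v⟫_ℝ = 0 := by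
  intro v hv
  have hsym : (((ContinuousLinearMap.adjoint J).comp J : Q →L[ℝ] Q) : Q →ₗ[ℝ] Q).IsSymmetric :=
    (ContinuousLinearMap.isPositive_adjoint_comp_self J).isSelfAdjoint.isSymmetric
  rw [← inner_adjoint_comp_self_apply]
  exact inner_map_sub_starProjection_eq_zero _ hsym V hV f v hv

/-- **Ambient Pythagoras along the form-domain projection.**
`‖J f‖² = ‖J (P f)‖² + ‖J (f − P f)‖²`. [folklore] -/
theorem norm_embed_sq_eq_add_of_invariant (J : Q →L[ℝ] H)
    (V : Submodule ℝ Q) [V.HasOrthogonalProjection]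
    (hV : ∀ v ∈ V, ((ContinuousLinearMap.adjoint J).comp J) v ∈ V) (f : Q) :
    ‖J f‖ ^ 2 = ‖J (V.starProjection f)‖ ^ 2 + ‖J (f - V.starProjection f)‖ ^ 2 := by
  set p := V.starProjection f
  have hpV : p ∈ V := Submodule.starProjection_apply_mem V f
  have h0 : ⟪J (f - p), J p⟫_ℝ = 0 := inner_embed_sub_starProjection_eq_zero J V hV f p hpV
  have hf : J f = J p + J (f - p) := by rw [← map_add]; congr 1; abel
  rw [hf, @norm_add_sq_real, real_inner_comm, h0]
  ring

/-- **Uniqueness.** If `J` is injective on `V` and `w ∈ V` has `J (f − w) ⊥_H J V`, then `w = P f`: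
the ambient projection onto `V` (when it exists) is the form-domain projection. [folklore] -/
theorem starProjection_unique_of_inner_embed (J : Q →L[ℝ] H)
    (V : Submodule ℝ Q) [V.HasOrthogonalProjection]
    (hV : ∀ v ∈ V, ((ContinuousLinearMap.adjoint J).comp J) v ∈ V)
    (hJ : ∀ v ∈ V, J v = 0 → v = 0) (f w : Q) (hw : w ∈ V)
    (horth : ∀ v ∈ V, ⟪J (f - w), J v⟫_ℝ = 0) :
    w = V.starProjection f := by
  set p := V.starProjection f
  have hpV : p ∈ V := Submodule.starProjection_apply_mem V f
  have hd : w - p ∈ V := V.sub_mem hw hpV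
  have h1 : ⟪J (f - p), J (w - p)⟫_ℝ = 0 := inner_embed_sub_starProjection_eq_zero J V hV f _ hd
  have h2 : ⟪J (f - w), J (w - p)⟫_ℝ = 0 := horth _ hd
  have h3 : ⟪J (w - p), J (w - p)⟫_ℝ = 0 := by
    have : J (w - p) = J (f - p) - J (f - w) := by rw [← map_sub]; congr 1; abel
    rw [show ⟪J (w - p), J (w - p)⟫_ℝ = ⟪J (f - p) - J (f - w), J (w - p)⟫_ℝ from by rw [← this],
      inner_sub_left, h1, h2]; ring
  have h4 : J (w - p) = 0 := inner_self_eq_zero.mp h3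
  have h5 : w - p = 0 := hJ _ hd h4
  exact sub_eq_zero.mp h5

/-- **The application shape (finite span of weak eigenvectors).** Let `ψ i` (`i : ι`, `ι` finite) be
weak eigenvectors of the form with levels `μ i ≠ 0`, and `V = span (ψ i)` (assumed to carry an
orthogonal projection — automatic for a finite family, `V` being finite-dimensional). Then the `Q`-orthogonal projection `P` onto `V` satisfies
`⟪J (f − P f), J v⟫_H = 0` for all `v ∈ V` and `‖J f‖² = ‖J (P f)‖² + ‖J (f − P f)‖²`. [folklore] -/
theorem inner_embed_sub_starProjection_span_eq_zero (J : Q →L[ℝ] H)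
    {ι : Type*} (ψ : ι → Q) (μ : ι → ℝ) (hμ : ∀ i, μ i ≠ 0)
    (hψ : ∀ i, ∀ y : Q, ⟪ψ i, y⟫_ℝ = μ i * ⟪J (ψ i), J y⟫_ℝ)
    [(Submodule.span ℝ (Set.range ψ)).HasOrthogonalProjection] (f : Q) :
    (∀ v ∈ Submodule.span ℝ (Set.range ψ),
      ⟪J (f - (Submodule.span ℝ (Set.range ψ)).starProjection f), J v⟫_ℝ = 0) ∧
    ‖J f‖ ^ 2 = ‖J ((Submodule.span ℝ (Set.range ψ)).starProjection f)‖ ^ 2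
      + ‖J (f - (Submodule.span ℝ (Set.range ψ)).starProjection f)‖ ^ 2 := by
  have hV := span_eigenvectors_invariant
    (((ContinuousLinearMap.adjoint J).comp J : Q →L[ℝ] Q) : Q →ₗ[ℝ] Q) ψ (fun i => (μ i)⁻¹)
    (fun i => adjoint_comp_self_eigen_of_weak J (hμ i) (hψ i))
  exact ⟨inner_embed_sub_starProjection_eq_zero J _ hV f,
    norm_embed_sq_eq_add_of_invariant J _ hV f⟩

end Literature.Analysis.OperatorTheory
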